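import Literature.AnabelianGeometry.SemiGraphs.PSCRankStatementsSmoothProper
import Literature.AnabelianGeometry.SemiGraphs.PSCThm16CapstoneProofs
import Literature.AnabelianGeometry.SemiGraphs.PSCSmoothProperGenuineSturdy
import Literature.AnabelianGeometry.SemiGraphs.PSCSmoothCurveGenuineRank
import Literature.AnabelianGeometry.SemiGraphs.ProSigmaCompletionMaxQuotient
import HarnessLib

/-!
# [CombGC] Thm. 1.6: the THIRTEEN origin statements of the capstone hold TOGETHER at the genuine
# smooth-proper origin (non-vacuity of `thm16_holds_of_inputs`)

Mochizuki, *A combinatorial version of the Grothendieck conjecture* [CombGC], Tohoku Math. J. **59**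
(2007), §1, Theorem 1.6 p. 13 with its cited inputs Def. 1.1 (ii) / Rmk. 1.1.3 / 1.1.5 / 1.1.6 / Prop. 1.2 /
Rmk. 1.3.1 / Prop. 1.5 and [IUTchI] Rmk. 1.2.3 (iv)(v). [cite: MochizukiCombGC2007, Thm 1.6 p.13]
[cite: MochizukiCombGC2007, Rmk 1.1.6 p.8] [cite: MochizukiCombGC2007, Def 1.1(ii) p.6]

PROOF-ONLY file (abc-iut cell, layer L3, [CombGC] non-vacuity programme; seat abc-iut-w5-d183 gen 4, row
«T16-INPUTS-NV@SP-GENUINE»).  The capstone `thm16_holds_of_inputs` (`PSCThm16CapstoneProofs.lean`)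
derives the typed Theorem 1.6 (i)(ii)(iii) over an origin `Ω` from profiniteness and THIRTEEN origin
statements BY NAME.  "Typed ≠ inhabited": here those thirteen statements are shown to hold SIMULTANEOUSLY
at a GENUINE, covering-closed origin — abc-iut-w5-d195's origin of genuine smooth-proper data (profinite
`Π`, one vertex with `Π_v = Π`, no nodes, no cusps, a pro-`Σ` completion `ι : S_g → Π` of the closed
surface group with `g ≥ 2 = genus(v)`; inhabited by `Ŝ₂`) — so the capstone's hypothesis list is
jointly satisfiable at genuine data, and Theorem 1.6 (i)(ii)(iii) follow there through the capstone.

* (private plumbing) a Hausdorff quotient of a profinite group is totally disconnected, and a continuous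
  bijective homomorphism from a compact onto a Hausdorff group is a topological isomorphism;
* `compactifyAlong_smoothProperGenuine` — [CombGC] Rmk. 1.1.6 at the origin: with no cusps
  `Ker(Π ↠ Π^cpt) = 1`, a presentation `f : Π ↠ Q` of `Π^cpt` is a topological isomorphism and the
  compactified datum is again genuine smooth-proper (`ι' = f ∘ ι`) ⟹ `CompactifyOfPSCTypeHolds`;
* `mapAlong_smoothProperGenuine` — the image along a presentation `f : Π ↠ Q` of the maximal pro-`S`
  quotient (`∅ ≠ S ⊆ Σ`) is genuine smooth-proper with `f ∘ ι` a pro-`S` completion of `S_g`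
  (abc-iut-L3's `comp_isMaxProSigmaQuotient`) ⟹ `MapAlongProLOfPSCTypeHolds`;
* **`exists_smoothProperGenuineOrigin_thm16_inputs_hold`** — at that origin: profiniteness and ALL of
  `RankStatementsHold` (this seat's `rankStatementsHold_of_smoothProper`), `CuspidalEdgeLikeCharacterizationHolds`,
  `NodalEdgeLikeCharacterizationHolds`, `CompactifyOfPSCTypeHolds`, `RestrictBDOfPSCTypeHolds`
  (abc-iut-w5-d195's `restrict_smoothProperGenuine`), `SturdyCoverHolds`, `OpenInterDeterminesComponentHolds`,
  `CommensurableTerminalityHolds`, `GraphicIffEdgeLikeVerticialHolds`, `UnrVerticialCharacterizationHolds'`,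
  `UnrVertAbOfRankHolds`, `VertCountLeNodeCountSuccHolds`, `MapAlongProLOfPSCTypeHolds` — and hence
  `NumericallyCuspidalIffHolds ∧ GraphicIffFiltrationPreservingHolds ∧ UnrVerticialIffHolds` BY the capstone.

Consistency / non-vacuity evidence at genuine one-component data (the Thm. 1.6 conclusions at this shape are
also direct, abc-iut-L3-t4's `…_of_smoothProper`); not the printed theorems for all pointed stable curves;
a FACT row is an assumption label; nothing here takes a side on [IUTchIII] Cor. 3.12.
-/

noncomputable section

namespace Literature.AnabelianGeometry.SemiGraphs

namespace PSCDatum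

open scoped Pointwise
open Literature.Topology.FourManifolds (SurfaceGroup)
open SemiGraphOfAnabelioids (IsProSigmaCompletion)
open Literature.IUT.HodgeTheaters (profiniteCompletion toCompletion)
open PSCCovering

universe u

/-! ### Plumbing: Hausdorff quotients of profinite groups -/

section Plumbing

/-- The continuous image of a compact space under a surjection is compact. [folklore] -/
private theorem compactSpace_of_surjective {P : Type u} [TopologicalSpace P] [CompactSpace P] {Q : Type u}
    [TopologicalSpace Q] {f : P → Q} (hf : Continuous f) (hs : Function.Surjective f) :
    CompactSpace Q :=
  ⟨by rw [← hs.range_eq]; exact isCompact_range hf⟩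

/-- **A Hausdorff quotient of a profinite group is totally disconnected**: for a continuous surjective
homomorphism `f : Π ↠ Q` from a compact totally disconnected group onto a Hausdorff group, the induced
continuous bijection `Π / ker f → Q` is a homeomorphism, and `Π / ker f` is totally disconnected
(`ker f` closed). [folklore] -/
private theorem totallyDisconnectedSpace_of_surjective {P : Type u} [Group P] [TopologicalSpace P]
    [IsTopologicalGroup P] [CompactSpace P] [TotallyDisconnectedSpace P] {Q : Type u} [Group Q]
    [TopologicalSpace Q] [T2Space Q] (f : P →* Q) (hf : Continuous f) (hs : Function.Surjective f) :
    TotallyDisconnectedSpace Q := by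
  have hK : IsClosed (f.ker : Set P) := by
    have : (f.ker : Set P) = f ⁻¹' {1} := by
      ext x
      simp only [SetLike.mem_coe, MonoidHom.mem_ker, Set.mem_preimage, Set.mem_singleton_iff]
    rw [this]
    exact isClosed_singleton.preimage hf
  haveI := AbsoluteAnabelian.QuotientGroup.totallyDisconnectedSpace_of_isClosed f.ker hK
  let φ : P ⧸ f.ker ≃* Q := QuotientGroup.quotientKerEquivOfSurjective f hs
  have hφ : Continuous φ := by
    refine (QuotientGroup.isQuotientMap_mk f.ker).continuous_iff.mpr ?_
    have : (φ : P ⧸ f.ker → Q) ∘ QuotientGroup.mk = f := by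
      funext x
      rfl
    rw [this]
    exact hf
  exact (Continuous.homeoOfEquivCompactToT2 (f := φ.toEquiv) hφ).totallyDisconnectedSpace

/-- A continuous BIJECTIVE homomorphism from a compact group onto a Hausdorff group is a topological
isomorphism. [folklore] -/
private theorem exists_continuousMulEquiv_of_bijective {P : Type u} [Group P] [TopologicalSpace P]
    [CompactSpace P] {Q : Type u} [Group Q] [TopologicalSpace Q] [T2Space Q] (f : P →* Q)
    (hf : Continuous f) (hb : Function.Bijective f) : ∃ e : P ≃ₜ* Q, ∀ x, e x = f x := by
  let h : P ≃ₜ Q := Continuous.homeoOfEquivCompactToT2 (f := Equiv.ofBijective f hb) hf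
  exact ⟨{ MulEquiv.ofBijective f hb with
      continuous_toFun := hf
      continuous_invFun := h.symm.continuous }, fun _ => rfl⟩

end Plumbing

/-! ### The two closure statements at genuine smooth-proper data -/

section Closure

variable {P : Type u} [Group P] [TopologicalSpace P] [IsTopologicalGroup P] [CompactSpace P] [T2Space P]
  [TotallyDisconnectedSpace P]
variable (G : PSCDatum P) [IsEmpty G.graph.N] [IsEmpty G.graph.C]
variable {Q : Type u} [Group Q] [TopologicalSpace Q] [IsTopologicalGroup Q] [T2Space Q]

omit [CompactSpace P] [TotallyDisconnectedSpace P] in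
/-- With no cusps and no nodes, `Ker(Π_G ↠ Π^cpt_G) = 1`. [cite: MochizukiCombGC2007, Rmk 1.1.6 p.8] -/
theorem cptKer_eq_bot_of_isEmpty : G.cptKer = ⊥ :=
  le_bot_iff.mp (G.cptKer_le_unrKer.trans (G.unrKer_eq_bot_of_isEmpty).le)

omit [IsTopologicalGroup Q] in
/-- **[CombGC] Rmk. 1.1.6 at genuine smooth-proper data.**  For a genuine smooth-proper datum `G` over the
profinite `Π` (one vertex `Π_v = Π`, no edges, `ι : S_g → Π` a pro-`Σ` completion, `genus = g`) and a
presentation `f : Π ↠ Q` of `Π^cpt_G` (`Q` Hausdorff, `ker f = Ker(Π ↠ Π^cpt) = 1`), the compactified datum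
`G.compactifyAlong f` is again genuine smooth-proper: `Q` is profinite, one vertex with `Π'_v = Q`, no
edges, and `f ∘ ι : S_g → Q` is a pro-`Σ` completion (`f` is a topological isomorphism).
[cite: MochizukiCombGC2007, Rmk 1.1.6 p.8] -/
theorem compactifyAlong_smoothProperGenuine (hV : ∀ v, G.vertGp v = ⊤) (v₀ : G.graph.V)
    (hv : ∀ w, w = v₀) {g : ℕ} (ι : SurfaceGroup g →* P) (hι : IsProSigmaCompletion G.Sigma ι)
    (hgen : ∀ v, G.genus v = g) (f : P →* Q) (hf : Continuous f) (hs : Function.Surjective f)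
    (hker : f.ker = G.cptKer) :
    CompactSpace Q ∧ TotallyDisconnectedSpace Q ∧ IsEmpty (G.compactifyAlong f hf hs).graph.N ∧
      IsEmpty (G.compactifyAlong f hf hs).graph.C ∧ (∀ w, (G.compactifyAlong f hf hs).vertGp w = ⊤) ∧
      (∃ w₀ : (G.compactifyAlong f hf hs).graph.V, ∀ w, w = w₀) ∧
      ∃ ι' : SurfaceGroup g →* Q, IsProSigmaCompletion (G.compactifyAlong f hf hs).Sigma ι' ∧
        ∀ w, (G.compactifyAlong f hf hs).genus w = g := by
  haveI : CompactSpace Q := compactSpace_of_surjective hf hs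
  have hinj : Function.Injective f := by
    rw [← MonoidHom.ker_eq_bot_iff, hker, G.cptKer_eq_bot_of_isEmpty]
  obtain ⟨e, he⟩ := exists_continuousMulEquiv_of_bijective f hf ⟨hinj, hs⟩
  have hι' : IsProSigmaCompletion G.Sigma (f.comp ι) := by
    have h := hι.comp_continuousMulEquiv e
    have heq : (e.toMulEquiv.toMonoidHom).comp ι = f.comp ι := MonoidHom.ext fun x => he (ι x)
    rwa [heq] at h
  refine ⟨inferInstance, totallyDisconnectedSpace_of_surjective f hf hs,
    inferInstanceAs (IsEmpty G.graph.N), inferInstanceAs (IsEmpty (Fin 0)), fun w => ?_, ⟨v₀, hv⟩,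
    f.comp ι, hι', fun w => hgen w⟩
  rw [compactifyAlong_vertGp, hV, Subgroup.map_top_of_surjective f hs]

omit [T2Space P] in
/-- **The image along the maximal pro-`S` quotient of genuine smooth-proper data** ([CombGC] Thm. 1.6
proof, p. 13: "we may assume that `Σ = {l}`"): for `∅ ≠ S ⊆ Σ` and a presentation `f : Π ↠ Q` of the
maximal pro-`S` quotient (`Q` Hausdorff), the image datum `G.mapAlong f` is genuine smooth-proper over the
profinite `Q`, with `f ∘ ι : S_g → Q` a pro-`S` completion (abc-iut-L3's `comp_isMaxProSigmaQuotient`).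
[cite: MochizukiCombGC2007, Thm 1.6(i) p.13] -/
theorem mapAlong_smoothProperGenuine (hV : ∀ v, G.vertGp v = ⊤) (v₀ : G.graph.V) (hv : ∀ w, w = v₀)
    {g : ℕ} (ι : SurfaceGroup g →* P) (hι : IsProSigmaCompletion G.Sigma ι) (hgen : ∀ v, G.genus v = g)
    (S : Set ℕ) (hS : S ⊆ G.Sigma) (hne : S.Nonempty) (f : P →* Q) (h : IsMaxProSigmaQuotient S f) :
    CompactSpace Q ∧ TotallyDisconnectedSpace Q ∧
      IsEmpty (G.mapAlong f h.continuous S hS hne h.proSigma).graph.N ∧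
      IsEmpty (G.mapAlong f h.continuous S hS hne h.proSigma).graph.C ∧
      (∀ w, (G.mapAlong f h.continuous S hS hne h.proSigma).vertGp w = ⊤) ∧
      (∃ w₀ : (G.mapAlong f h.continuous S hS hne h.proSigma).graph.V, ∀ w, w = w₀) ∧
      ∃ ι' : SurfaceGroup g →* Q,
        IsProSigmaCompletion (G.mapAlong f h.continuous S hS hne h.proSigma).Sigma ι' ∧
          ∀ w, (G.mapAlong f h.continuous S hS hne h.proSigma).genus w = g := by
  haveI : CompactSpace Q := compactSpace_of_surjective h.continuous h.surjective
  have hι' : IsProSigmaCompletion S (f.comp ι) := IsProSigmaCompletion.comp_isMaxProSigmaQuotient hS hι h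
  refine ⟨inferInstance, totallyDisconnectedSpace_of_surjective f h.continuous h.surjective,
    inferInstanceAs (IsEmpty G.graph.N), inferInstanceAs (IsEmpty G.graph.C), fun w => ?_, ⟨v₀, hv⟩,
    f.comp ι, hι', fun w => hgen w⟩
  rw [mapAlong_vertGp, hV, Subgroup.map_top_of_surjective f h.surjective]

end Closure

/-! ### The thirteen inputs of the capstone, jointly, at the genuine smooth-proper origin -/

/-- **NON-VACUITY OF THE CAPSTONE `thm16_holds_of_inputs` AT GENUINE DATA.**  Let `Ω` declare "of
PSC-type" exactly the genuine smooth-proper data (abc-iut-w5-d195's origin): data over a PROFINITE group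
with no nodes, no cusps, one vertex with `Π_v = Π`, and a pro-`Σ` completion `ι : S_g → Π` of the closed
surface group with `g ≥ 2 = genus(v)`.  Then `Ω` is INHABITED by the sturdy datum `Ŝ₂` (profinite
completion of `S_2`, `Σ` = all primes), every `Ω`-datum is profinite, and ALL THIRTEEN origin statements of
the capstone hold at `Ω` — [CombGC] Rmk. 1.1.3 / 1.3.1 `RankStatementsHold`, [IUTchI] Rmk. 1.2.3 (iv)/(v)
`CuspidalEdgeLikeCharacterizationHolds` / `NodalEdgeLikeCharacterizationHolds`, Rmk. 1.1.6
`CompactifyOfPSCTypeHolds`, Def. 1.1 (ii) `RestrictBDOfPSCTypeHolds`, Rmk. 1.1.5 `SturdyCoverHolds`,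
Prop. 1.2 (i) `OpenInterDeterminesComponentHolds`, Prop. 1.2 (ii) `CommensurableTerminalityHolds`, Prop. 1.5
(ii) `GraphicIffEdgeLikeVerticialHolds`, the corrected Rmk. 1.2.3 (iv) `UnrVerticialCharacterizationHolds'`,
Rmk. 1.1.5 `UnrVertAbOfRankHolds`, connectedness `VertCountLeNodeCountSuccHolds`, "we may assume `Σ = {l}`"
`MapAlongProLOfPSCTypeHolds` — whence [CombGC] Thm. 1.6 (i)(ii)(iii) AS TYPED hold at `Ω` THROUGH
`thm16_holds_of_inputs`.  Consistency / non-vacuity evidence; not the printed theorems for all pointed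
stable curves. [cite: MochizukiCombGC2007, Thm 1.6 p.13] -/
theorem exists_smoothProperGenuineOrigin_thm16_inputs_hold :
    ∃ Ω : PSCOrigin.{0},
      (∃ G : PSCDatum (profiniteCompletion (SurfaceGroup 2)),
        Ω.IsOfPSCType G ∧ G.IsSturdy ∧ G.Sigma = {p | p.Prime} ∧ G.graph.i = 1 ∧ G.graph.n = 0 ∧
          G.graph.r = 0 ∧ (∀ v, G.vertGp v = ⊤ ∧ G.genus v = 2) ∧
          IsProSigmaCompletion G.Sigma (toCompletion (SurfaceGroup 2))) ∧
      (∀ ⦃Q : Type⦄ [Group Q] [TopologicalSpace Q] [IsTopologicalGroup Q] (K : PSCDatum Q),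
          Ω.IsOfPSCType K → CompactSpace Q ∧ TotallyDisconnectedSpace Q) ∧
      RankStatementsHold Ω ∧ CuspidalEdgeLikeCharacterizationHolds Ω ∧
      NodalEdgeLikeCharacterizationHolds Ω ∧ CompactifyOfPSCTypeHolds Ω ∧ RestrictBDOfPSCTypeHolds Ω ∧
      SturdyCoverHolds Ω ∧ OpenInterDeterminesComponentHolds Ω ∧ CommensurableTerminalityHolds Ω ∧
      GraphicIffEdgeLikeVerticialHolds Ω ∧ UnrVerticialCharacterizationHolds' Ω ∧ UnrVertAbOfRankHolds Ω ∧
      VertCountLeNodeCountSuccHolds Ω ∧ MapAlongProLOfPSCTypeHolds Ω ∧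
      (NumericallyCuspidalIffHolds Ω ∧ GraphicIffFiltrationPreservingHolds Ω ∧ UnrVerticialIffHolds Ω) := by
  let Ω : PSCOrigin.{0} :=
    ⟨fun {Q} _ _ G => ∃ (_ : IsTopologicalGroup Q), CompactSpace Q ∧ T2Space Q ∧
      TotallyDisconnectedSpace Q ∧ IsEmpty G.graph.N ∧ IsEmpty G.graph.C ∧ (∀ v, G.vertGp v = ⊤) ∧
      (∃ v₀ : G.graph.V, ∀ w, w = v₀) ∧
      ∃ (g : ℕ) (ι : SurfaceGroup g →* Q), 2 ≤ g ∧ IsProSigmaCompletion G.Sigma ι ∧ ∀ v, G.genus v = g⟩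
  -- the hypothesis shapes of the origin-level lemmas, read off `Ω`
  have hΩ : ∀ ⦃Q : Type⦄ [Group Q] [TopologicalSpace Q] (G : PSCDatum Q), Ω.IsOfPSCType G →
      IsEmpty G.graph.N ∧ IsEmpty G.graph.C ∧ (∀ v, G.vertGp v = ⊤) ∧ ∃ v₀ : G.graph.V, ∀ w, w = v₀ := by
    intro Q _ _ G hG
    obtain ⟨_, -, -, -, hN, hC, hV, hv, -⟩ := hG
    exact ⟨hN, hC, hV, hv⟩
  have hΩv : ∀ ⦃Q : Type⦄ [Group Q] [TopologicalSpace Q] (G : PSCDatum Q), Ω.IsOfPSCType G →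
      (∀ v, G.vertGp v = ⊤) ∧ ∃ v₀ : G.graph.V, ∀ w, w = v₀ := fun Q _ _ G hG =>
    ⟨(hΩ G hG).2.2.1, (hΩ G hG).2.2.2⟩
  have hΩgen : ∀ ⦃Q : Type⦄ [Group Q] [TopologicalSpace Q] [IsTopologicalGroup Q] (G : PSCDatum Q),
      Ω.IsOfPSCType G → CompactSpace Q ∧ T2Space Q ∧ TotallyDisconnectedSpace Q ∧ IsEmpty G.graph.N ∧
        IsEmpty G.graph.C ∧ (∀ v, G.vertGp v = ⊤) ∧ (∃ v₀ : G.graph.V, ∀ w, w = v₀) ∧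
        ∃ (g : ℕ) (ι : SurfaceGroup g →* Q), 2 ≤ g ∧ IsProSigmaCompletion G.Sigma ι ∧
          ∀ v, G.genus v = g := by
    intro Q _ _ _ G hG
    obtain ⟨_, h⟩ := hG
    exact h
  have hΩrk : ∀ ⦃Q : Type⦄ [Group Q] [TopologicalSpace Q] [IsTopologicalGroup Q] (G : PSCDatum Q),
      Ω.IsOfPSCType G → T2Space Q ∧ IsEmpty G.graph.N ∧ IsEmpty G.graph.C ∧ (∀ v, G.vertGp v = ⊤) ∧
        ∃ (g : ℕ) (ι : SurfaceGroup g →* Q), IsProSigmaCompletion G.Sigma ι ∧ ∀ v, G.genus v = g := by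
    intro Q _ _ _ G hG
    obtain ⟨_, -, ht, -, hN, hC, hV, -, g, ι, -, hι, hgen⟩ := hG
    exact ⟨ht, hN, hC, hV, g, ι, hι, hgen⟩
  have hprof : ∀ ⦃Q : Type⦄ [Group Q] [TopologicalSpace Q] [IsTopologicalGroup Q] (K : PSCDatum Q),
      Ω.IsOfPSCType K → CompactSpace Q ∧ TotallyDisconnectedSpace Q := by
    intro Q _ _ _ K hK
    obtain ⟨_, hc, -, hd, -⟩ := hK
    exact ⟨hc, hd⟩
  -- the genuine datum `Ŝ₂`
  let G : PSCDatum (profiniteCompletion (SurfaceGroup 2)) :=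
    { Sigma := {p | p.Prime}
      sigma_prime := fun _ hp => hp
      sigma_nonempty := ⟨2, Nat.prime_two⟩
      graph := { V := Unit, N := Empty, C := Empty, nodeEnds := Empty.elim, cuspEnd := Empty.elim }
      vertGp := fun _ => ⊤
      nodeGp := Empty.elim
      cuspGp := Empty.elim
      genus := fun _ => 2
      isClosed_vertGp := fun _ => by rw [Subgroup.coe_top]; exact isClosed_univ
      isClosed_nodeGp := fun e => e.elim
      isClosed_cuspGp := fun c => c.elim
      nodeGp_le := fun e => e.elim
      cuspGp_le := fun c => c.elim
      proSigma := ⟨fun _ _ _ hp _ => hp⟩ }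
  have hι : IsProSigmaCompletion G.Sigma (toCompletion (SurfaceGroup 2)) :=
    IsProSigmaCompletion.isProSigmaCompletion_toCompletion (SurfaceGroup 2)
  have hG : Ω.IsOfPSCType G :=
    ⟨inferInstance, inferInstance, inferInstance, inferInstance, inferInstanceAs (IsEmpty Empty),
      inferInstanceAs (IsEmpty Empty), fun _ => rfl, ⟨(), fun _ => rfl⟩, 2, toCompletion (SurfaceGroup 2),
      le_rfl, hι, fun _ => rfl⟩
  -- the thirteen origin statements
  have hrank : RankStatementsHold Ω := rankStatementsHold_of_smoothProper Ω hΩ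
  have hcusp : CuspidalEdgeLikeCharacterizationHolds Ω :=
    cuspidalEdgeLikeCharacterizationHolds_of_smoothProper Ω hΩ
  have hnodal : NodalEdgeLikeCharacterizationHolds Ω := nodalEdgeLikeCharacterizationHolds_of_smoothProper Ω hΩ
  have hcpt : CompactifyOfPSCTypeHolds Ω := by
    intro R _ _ _ _ R' _ _ _ _ H f hf hs hker hH _
    obtain ⟨_, hc, ht, hd, hN, hC, hV, ⟨v₀, hv⟩, g, ι, hg, hιH, hgen⟩ := hH
    obtain ⟨hc', hd', hN', hC', hV', hv', ι', hι', hgen'⟩ :=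
      H.compactifyAlong_smoothProperGenuine hV v₀ hv ι hιH hgen f hf hs hker
    exact ⟨inferInstance, hc', inferInstance, hd', hN', hC', hV', hv', g, ι', hg, hι', hgen'⟩
  have hres : RestrictBDOfPSCTypeHolds Ω := by
    intro R _ _ _ H hH
    obtain ⟨_, hc, ht, hd, hN, hC, hV, ⟨v₀, hv⟩, g, ι, hg, hιH, hgen⟩ := hH
    refine ⟨H.chosenBranchData, fun U _ hU => ?_⟩
    rw [restrictBD_chosen]
    haveI : CompactSpace U := isCompact_iff_compactSpace.mp (U.isClosed_of_isOpen hU).isCompact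
    obtain ⟨hN', hC', hV', hv', g', ι', hg', hι', hgen'⟩ :=
      H.restrict_smoothProperGenuine U hU hV v₀ hv hg ι hιH hgen
    exact ⟨inferInstance, inferInstance, inferInstance, inferInstance, hN', hC', hV', hv', g', ι', hg', hι',
      hgen'⟩
  have hcover : SturdyCoverHolds Ω := sturdyCoverHolds_of_smoothProperGenuine Ω hΩgen
  have hopen : OpenInterDeterminesComponentHolds Ω := openInterDeterminesComponentHolds_of_smoothProper Ω hΩ
  have hCT : CommensurableTerminalityHolds Ω := commensurableTerminalityHolds_of_smoothProper Ω hΩ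
  have hP15 : GraphicIffEdgeLikeVerticialHolds Ω := graphicIffEdgeLikeVerticialHolds_of_smoothProper Ω hΩ
  have hunr : UnrVerticialCharacterizationHolds' Ω := unrVerticialCharacterizationHolds'_of_smoothProper Ω hΩ
  have hrankv : UnrVertAbOfRankHolds Ω := unrVertAbOfRankHolds_of_smoothProperGenuine Ω hΩrk
  have hconn : VertCountLeNodeCountSuccHolds Ω := vertCountLeNodeCountSuccHolds_of_vertGp_eq_top Ω hΩv
  have hmap : MapAlongProLOfPSCTypeHolds Ω := by
    intro R _ _ _ _ R' _ _ _ _ H S hS hne f h hH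
    obtain ⟨_, hc, ht, hd, hN, hC, hV, ⟨v₀, hv⟩, g, ι, hg, hιH, hgen⟩ := hH
    obtain ⟨hc', hd', hN', hC', hV', hv', ι', hι', hgen'⟩ :=
      H.mapAlong_smoothProperGenuine hV v₀ hv ι hιH hgen S hS hne f h
    exact ⟨inferInstance, hc', inferInstance, hd', hN', hC', hV', hv', g, ι', hg, hι', hgen'⟩
  exact ⟨Ω, ⟨G, hG, fun _ => le_rfl, rfl, rfl, rfl, rfl, fun _ => ⟨rfl, rfl⟩, hι⟩, hprof, hrank, hcusp,
    hnodal, hcpt, hres, hcover, hopen, hCT, hP15, hunr, hrankv, hconn, hmap,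
    thm16_holds_of_inputs Ω hprof hrank hcusp hnodal hcpt hres hcover hopen hCT hP15 hunr hrankv hconn hmap⟩

end PSCDatum

end Literature.AnabelianGeometry.SemiGraphs
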